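import Summits.Langlands.Langlands.Theorems.MonomialSerreAtSplitPrimes.Negative.PureCubicPrimes

/-!
# `MonomialSerreAtSplitPrimes` (stmt-Langlands-16951), negative side V: the witness field `ℚ(∛2)`

Part 2 of 2 of the number-field input (supports stmt-Langlands-16951):

* §10 `primesOver_of_mod_three_eq_two`: in `ℚ(∛m)` a prime `ℓ ≡ 2 (mod 3)`, `ℓ ∤ 3m`, has exactly two
  primes above it, of residue degrees `1` and `2`; `split_thirtyone`: `31` splits completely in
  `ℚ(∛2)` — `e = f = 1` at every prime above `31` (`X³ - 2 ≡ (X-4)(X-7)(X-20) (mod 31)`, separable).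
* §11 the field `ℚ(∛2) = ℚ[X]/(X³ - 2)` (Mathlib `AdjoinRoot`, under `[Fact (Irreducible (X³ - 2))]`):
  degree `3`, an algebraic integer `θ` with `θ³ = 2`, a UNIQUE ring map to `ℝ`, hence `r₁ ≤ 1`.
* §12 `cubicTwo_splitData`: for every prime `ℓ > 3` with `3 ∣ ℓ + 1` there are exactly two places of
  `ℚ(∛2)` over the place of `ℚ` containing `ℓ`, of residue degrees `1` and `2` over `𝓞 ℚ` — the
  hypothesis `hH` of `monomialSerreAtSplitPrimes_false_of_cubicField` with `M₀ = B₀ = 3`.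

References: H. Cohen, GTM 138 (1993), §6.4 [Cohen1993].
-/

noncomputable section

set_option linter.dupNamespace false -- `Summit.Langlands.Langlands` is the mandated namespace (D-0017)

open scoped NumberField Polynomial
open IsDedekindDomain NumberField Polynomial Ideal
open Literature.NumberTheory.NumberFields Literature.NumberTheory.NumberFields.MonicCubic
  Literature.NumberTheory.NumberFields.PureCubic

namespace Summit.Langlands.Langlands.Theorems.MonomialSerreAtSplitPrimes.Negative

/-! ## 10. Splitting in a pure cubic field: `ℓ ≡ 2 (mod 3)` and complete splitting of `31` in `ℚ(∛2)` -/

section Splitting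

variable {K : Type} [Field K] [NumberField K] {m : ℕ} {θ : 𝓞 K}

/-- **In `ℚ(∛m)` a prime `ℓ ≡ 2 (mod 3)`, `ℓ ∤ 3m`, has exactly two primes above it, of residue degrees
`1` and `2`** (`X³ - m ≡ (X - r)(X² + rX + r²)`, the quadratic irreducible). [cite: Cohen1993, §6.4] -/
theorem primesOver_of_mod_three_eq_two (h3K : Module.finrank ℚ K = 3) (hm : ∀ r : ℕ, r ^ 3 ≠ m)
    (hθ : θ ^ 3 = (m : 𝓞 K)) {ℓ : ℕ} (hℓ : ℓ.Prime) (hℓ3 : ℓ % 3 = 2) (hℓm : ¬ ℓ ∣ 3 * m) :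
    ∃ P₁ P₂ : Ideal (𝓞 K), P₁ ≠ P₂ ∧ primesOver (span {(ℓ : ℤ)}) (𝓞 K) = {P₁, P₂} ∧
      P₁.inertiaDeg ℤ = 1 ∧ P₂.inertiaDeg ℤ = 2 := by
  haveI := Fact.mk hℓ
  obtain ⟨r, hr⟩ := cube_surjective hℓ3 (m : ZMod ℓ)
  have hr' : r ^ 3 = (m : ZMod ℓ) := hr
  have hmℓ : (m : ZMod ℓ) ≠ 0 := by
    rw [Ne, ZMod.natCast_eq_zero_iff]
    exact fun h => hℓm (h.mul_left 3)
  have hr0 : r ≠ 0 := by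
    rintro rfl
    apply hmℓ
    rw [← hr']
    simp
  have hfac : (X ^ 3 - C (m : ZMod ℓ) : (ZMod ℓ)[X]) = (X - C r) * (X ^ 2 + C r * X + C (r ^ 2)) := by
    rw [← hr']; exact X_pow_three_sub_eq_mul r
  have hmon₂ : (X ^ 2 + C r * X + C (r ^ 2) : (ZMod ℓ)[X]).Monic := by monicity!
  obtain ⟨P₁, P₂, hne, hset, hf₁, hf₂⟩ := primesOver_of_two_factors h3K hm hθ hℓ hℓm
    (irreducible_X_sub_C r) (monic_X_sub_C r) (quadratic_irreducible hℓ3 hr0) hmon₂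
    (X_sub_C_ne_quadratic r) hfac
  refine ⟨P₁, P₂, hne, hset, by rw [hf₁, natDegree_X_sub_C], ?_⟩
  rw [hf₂]
  compute_degree!

/-- `2` is not a cube. [folklore] -/
theorem two_not_cube (r : ℕ) : r ^ 3 ≠ 2 := by
  intro h
  have h1 : r < 2 := by
    by_contra hle
    push Not at hle
    have := Nat.pow_le_pow_left hle 3
    omega
  interval_cases r <;> simp at h

/-- `X³ - 2 ≡ (X - 4)(X - 7)(X - 20) (mod 31)`. [folklore] -/
theorem X_pow_three_sub_two_mod_thirtyone :
    (X ^ 3 - C ((2 : ℕ) : ZMod 31) : (ZMod 31)[X]) = (X - C 4) * (X - C 7) * (X - C 20) := by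
  haveI : Fact (Nat.Prime 31) := ⟨by norm_num⟩
  have h31 : ((31 : ℕ) : (ZMod 31)[X]) = 0 := by
    rw [← map_natCast C, ZMod.natCast_self, map_zero]
  simp only [map_ofNat, Nat.cast_ofNat] at h31 ⊢
  linear_combination (X ^ 2 - 8 * X + 18 : (ZMod 31)[X]) * h31

/-- **`31` splits completely in `ℚ(∛2)`**: `e = f = 1` at every prime above `31`
(`X³ - 2 ≡ (X-4)(X-7)(X-20) (mod 31)`, distinct linear factors). [cite: Cohen1993, §6.4] -/
theorem split_thirtyone (h3K : Module.finrank ℚ K = 3) (hθ : θ ^ 3 = ((2 : ℕ) : 𝓞 K))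
    (v : HeightOneSpectrum (𝓞 K)) (hv : ((31 : ℕ) : 𝓞 K) ∈ v.asIdeal) :
    v.asIdeal.ramificationIdx ℤ = 1 ∧ v.asIdeal.inertiaDeg ℤ = 1 := by
  have h31 : Nat.Prime 31 := by norm_num
  haveI : Fact (Nat.Prime 31) := ⟨h31⟩
  have hP : v.asIdeal ∈ primesOver (span {((31 : ℕ) : ℤ)}) (𝓞 K) :=
    ⟨v.isPrime, ⟨(int_under_eq_span h31 hv).symm⟩⟩
  obtain ⟨Q, hirr, hmon, hdvd, hf, he⟩ :=
    exists_factor_of_mem_primesOver h3K two_not_cube hθ h31 (by norm_num) hP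
  -- `Q` is one of the three linear factors
  have hdvd' := hdvd
  rw [X_pow_three_sub_two_mod_thirtyone] at hdvd'
  have hdeg : Q.natDegree = 1 := by
    have hpos : 0 < Q.natDegree := natDegree_pos_iff_degree_pos.2 (degree_pos_of_irreducible hirr)
    have hle : Q.natDegree ≤ 1 := by
      rcases hirr.prime.dvd_or_dvd hdvd' with h | h
      · rcases hirr.prime.dvd_or_dvd h with h | h
        · exact (natDegree_le_of_dvd h (X_sub_C_ne_zero _)).trans (natDegree_X_sub_C _).le
        · exact (natDegree_le_of_dvd h (X_sub_C_ne_zero _)).trans (natDegree_X_sub_C _).le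
      · exact (natDegree_le_of_dvd h (X_sub_C_ne_zero _)).trans (natDegree_X_sub_C _).le
    omega
  -- multiplicity `1`: the cubic is separable
  have hsep : (X ^ 3 - C ((2 : ℕ) : ZMod 31) : (ZMod 31)[X]).Separable :=
    separable_X_pow_sub_C _ (by rw [Ne, ZMod.natCast_eq_zero_iff]; norm_num)
      (by rw [Ne, ZMod.natCast_eq_zero_iff]; norm_num)
  have hmult : multiplicity Q (X ^ 3 - C ((2 : ℕ) : ZMod 31) : (ZMod 31)[X]) = 1 := by
    apply multiplicity_eq_of_emultiplicity_eq_some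
    rw [Nat.cast_one]
    exact le_antisymm (emultiplicity_le_one_of_separable hirr.not_isUnit hsep)
      (Order.one_le_iff_pos.2 (emultiplicity_pos_of_dvd hdvd))
  exact ⟨he.trans hmult, hf.trans hdeg⟩

end Splitting

/-! ## 11. The field `ℚ(∛2) = ℚ[X]/(X³ - 2)`: degree `3`, one real place -/

section CubicTwo

/-- `X³ - 2 ∈ ℚ[X]` is irreducible (`2` is not a cube). [folklore] -/
theorem irreducible_X_pow_three_sub_two : Irreducible (X ^ 3 - C (2 : ℚ) : ℚ[X]) := by
  have := irreducible_polyQ (m := 2) two_not_cube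
  rw [polyQ_eq_X_pow_sub_C] at this
  exact_mod_cast this

variable [hirr : Fact (Irreducible (X ^ 3 - C (2 : ℚ) : ℚ[X]))]

/-- `[ℚ(∛2) : ℚ] = 3`. [folklore] -/
theorem finrank_cubicTwo : Module.finrank ℚ (AdjoinRoot (X ^ 3 - C (2 : ℚ))) = 3 := by
  rw [(AdjoinRoot.powerBasis hirr.out.ne_zero).finrank, AdjoinRoot.powerBasis_dim,
    natDegree_X_pow_sub_C]

/-- The class of `X` is a cube root of `2`. [folklore] -/
theorem root_pow_three : (AdjoinRoot.root (X ^ 3 - C (2 : ℚ))) ^ 3 = 2 := by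
  have h := AdjoinRoot.eval₂_root (X ^ 3 - C (2 : ℚ))
  rw [eval₂_sub, eval₂_X_pow, eval₂_C, sub_eq_zero] at h
  rw [h]
  exact map_ofNat (AdjoinRoot.of _) 2

/-- An algebraic integer `θ ∈ ℚ(∛2)` with `θ³ = 2`. [folklore] -/
theorem exists_theta : ∃ θ : 𝓞 (AdjoinRoot (X ^ 3 - C (2 : ℚ))),
    θ ^ 3 = ((2 : ℕ) : 𝓞 (AdjoinRoot (X ^ 3 - C (2 : ℚ)))) := by
  obtain ⟨θ, -, hθ⟩ := exists_ringOfIntegers_of_cube_eq (K := AdjoinRoot (X ^ 3 - C (2 : ℚ)))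
    (m := 2) (α := AdjoinRoot.root (X ^ 3 - C (2 : ℚ))) (by rw [root_pow_three]; norm_num)
  exact ⟨θ, hθ⟩

/-- **`ℚ(∛2)` has a unique real embedding** (a ring map to `ℝ` sends `∛2` to the unique real cube root
of `2`, and is determined by it). [folklore] -/
theorem ringHom_real_eq (σ₁ σ₂ : AdjoinRoot (X ^ 3 - C (2 : ℚ)) →+* ℝ) : σ₁ = σ₂ := by
  have hroot : ∀ σ : AdjoinRoot (X ^ 3 - C (2 : ℚ)) →+* ℝ,
      σ (AdjoinRoot.root (X ^ 3 - C (2 : ℚ))) ^ 3 = 2 := fun σ => by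
    rw [← map_pow, root_pow_three, map_ofNat]
  have heq : σ₁ (AdjoinRoot.root (X ^ 3 - C (2 : ℚ))) = σ₂ (AdjoinRoot.root (X ^ 3 - C (2 : ℚ))) :=
    (Odd.strictMono_pow (by decide : Odd 3)).injective ((hroot σ₁).trans (hroot σ₂).symm)
  refine RingHom.ext fun x => ?_
  obtain ⟨g, rfl⟩ := AdjoinRoot.mk_surjective x
  rw [← AdjoinRoot.aeval_eq, aeval_def, Polynomial.hom_eval₂, Polynomial.hom_eval₂, heq]
  congr 1
  exact RingHom.ext_rat _ _

open NumberField.InfinitePlace in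
/-- **`ℚ(∛2)` has at most one real place.** [folklore] -/
theorem nrRealPlaces_cubicTwo_le : nrRealPlaces (AdjoinRoot (X ^ 3 - C (2 : ℚ))) ≤ 1 := by
  classical
  rw [← card_real_embeddings]
  refine Fintype.card_le_one_iff_subsingleton.2 ⟨fun φ ψ => Subtype.ext ?_⟩
  have h := ringHom_real_eq φ.2.embedding ψ.2.embedding
  refine RingHom.ext fun x => ?_
  have hφ := ComplexEmbedding.IsReal.coe_embedding_apply φ.2 x
  have hψ := ComplexEmbedding.IsReal.coe_embedding_apply ψ.2 x
  rw [← hφ, ← hψ, h]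

end CubicTwo

/-! ## 12. The hypotheses of `monomialSerreAtSplitPrimes_false_of_cubicField` hold for `ℚ(∛2)` -/

/-- **Split data for `ℚ(∛2)`**: for every prime `ℓ > 3` with `3 ∣ ℓ + 1` there are exactly two places
of `ℚ(∛2)` above the place of `ℚ` containing `ℓ`, of residue degrees `1` and `2` over `𝓞 ℚ`.
[cite: Cohen1993, §6.4] -/
theorem cubicTwo_splitData [Fact (Irreducible (X ^ 3 - C (2 : ℚ) : ℚ[X]))]
    {θ : 𝓞 (AdjoinRoot (X ^ 3 - C (2 : ℚ)))} (hθ : θ ^ 3 = ((2 : ℕ) : 𝓞 (AdjoinRoot (X ^ 3 - C (2 : ℚ)))))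
    (ℓ : ℕ) (hℓ : ℓ.Prime) (hB : 3 < ℓ) (hdvd : 3 ∣ ℓ + 1)
    (v : HeightOneSpectrum (𝓞 ℚ)) (hv : ((ℓ : ℕ) : 𝓞 ℚ) ∈ v.asIdeal) :
    ∃ w₁ w₂ : HeightOneSpectrum (𝓞 (AdjoinRoot (X ^ 3 - C (2 : ℚ)))), w₁ ≠ w₂ ∧
      {w : HeightOneSpectrum (𝓞 (AdjoinRoot (X ^ 3 - C (2 : ℚ)))) |
        w.asIdeal.under (𝓞 ℚ) = v.asIdeal} = {w₁, w₂} ∧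
      w₁.asIdeal.inertiaDeg (𝓞 ℚ) = 1 ∧ w₂.asIdeal.inertiaDeg (𝓞 ℚ) = 2 := by
  have hℓ3 : ℓ % 3 = 2 := by omega
  have hℓm : ¬ ℓ ∣ 3 * 2 := by
    intro h
    have := Nat.le_of_dvd (by norm_num) h
    interval_cases ℓ <;> omega
  obtain ⟨P₁, P₂, hne, hset, hf₁, hf₂⟩ :=
    primesOver_of_mod_three_eq_two finrank_cubicTwo two_not_cube hθ hℓ hℓ3 hℓm
  obtain ⟨w₁, w₂, hne', hset', hg₁, hg₂⟩ := places_over_of_primesOver hℓ hne hset v hv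
  exact ⟨w₁, w₂, hne', hset', hg₁.trans hf₁, hg₂.trans hf₂⟩



end Summit.Langlands.Langlands.Theorems.MonomialSerreAtSplitPrimes.Negative

end
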